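import Literature.AlgebraicGeometry.Motives.FamiliesVHSProd
import Literature.AlgebraicGeometry.Motives.FamiliesVHSMorphism
import Literature.AlgebraicGeometry.Motives.HodgeClassesBoundedNormFinite
import HarnessLib

/-!
# Morphisms of VHS data form abelian groups; the direct sum `D₁ ⊕ D₂` is a biproduct (projections, injections, universal maps, `φ ⊕ ψ`);
# the Hodge loci of `D₁ ⊕ D₂` are the unions of the Hodge loci of the summands

Topic `Literature/AlgebraicGeometry/Motives` (namespace `Literature.AlgebraicGeometry.Motives.VHSData`), lane `lit-hodgefound` (seat `p08`, row g57-#3).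
DEFINITIONS WITH BODIES (`Hom.zero`, `Hom.add`, `Hom.neg`, `Hom.sub`, `Hom.fst`, `Hom.snd`, `Hom.inl`, `Hom.inr`, `Hom.prodLift`, `Hom.coprodDesc`,
`Hom.prodMap`) and their API; no named fact, no instance (the group laws are stated as equations, not as an `AddCommGroup` instance), no notation
(D-0026 net debt `0`).  Sequel of `Motives/FamiliesVHSProd` (`VHSData.prod`, seat p08 g56-#14) and `Motives/FamiliesVHSMorphism` (`VHSData.Hom`,
g56-#15); the positivity input of §5 is the tree's `Polarization.form_self_pos_of_mem_hodgeClasses` (`Motives/HodgeClassesBoundedNormFinite`).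

PRINTED SOURCES.  P. Deligne, *Équations différentielles à points singuliers réguliers*, LNM 163 (1970), I.1: local systems of `R`-modules on `S`
form an ABELIAN (`⊗`-)category, operations fibrewise.  P. Deligne, *Théorie de Hodge II*, Publ. Math. IHÉS 40 (1971), 2.1 (direct sums of Hodge
structures; morphisms), Thm. 2.3.5 (Hodge structures of weight `n` form an abelian category).  W. Schmid, *Variation of Hodge structure*, Invent.
Math. 22 (1973), §2 ∕ P. Griffiths, *Periods of integrals on algebraic manifolds III*, Publ. Math. IHÉS 38 (1970), §1: polarized variations are
stable under direct sums; morphisms of variations.  C. Voisin, *Hodge Theory and Complex Algebraic Geometry I*, §7.3.1 (variations and their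
morphisms), §7.1.2 Def. 7.7 (positivity of a polarization on `(p,p)`-classes).  E. Cattani, P. Deligne, A. Kaplan, *On the locus of Hodge classes*,
J. AMS 8 (1995), §1, Thm. 1.1 (the locus `S^{(K)}` of integral Hodge classes `u` with `Q(u, u) ≤ K`).

* §1 **the abelian group of morphisms** `Hom D₁ D₂`: `homRat_zero ∕ _neg ∕ _sub`; `Hom.zero`, `Hom.add`, `Hom.neg`, `Hom.sub` (lattice maps `0`,
  `φ_s + ψ_s`, `−φ_s`, `φ_s − ψ_s`; flat and Hodge because `homRat` is additive and `F^p` is mapped into `F^p` by sums), `rfl` lemmas `zero_app`,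
  `add_app`, `neg_app`, `sub_app`, and the laws `add_comm`, `add_assoc`, `zero_add`, `add_zero`, `neg_add_cancel`, `comp_add`, `add_comp`, `comp_zero`,
  `zero_comp` (as equations of morphisms).
* §2 (private) the complexification of `f × g`, `f ∘ pr₁`, `f ∘ pr₂` read through the tree's `HodgeStructure.prodEquiv`.
* §3 **the biproduct structure maps of `D₁ ⊕ D₂`**: `homRat_fst ∕ _snd ∕ _prod ∕ _coprod`, the morphisms **`Hom.fst`, `Hom.snd`** (projections),
  **`Hom.inl`, `Hom.inr`** (injections), **`Hom.prodLift φ ψ : D → D₁ ⊕ D₂`**, **`Hom.coprodDesc φ ψ : D₁ ⊕ D₂ → D`**, **`Hom.prodMap φ ψ : D₁ ⊕ D₂ →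
  D₁' ⊕ D₂'`**, with their lattice maps (`LinearMap.fst ∕ snd ∕ inl ∕ inr ∕ prod ∕ coprod ∕ prodMap`).
* §4 **biproduct identities**: `fst_comp_inl = id`, `snd_comp_inr = id`, `fst_comp_inr = 0`, `snd_comp_inl = 0`, `fst_comp_prodLift`, `snd_comp_prodLift`,
  `prodLift_unique`, `coprodDesc_comp_inl`, `coprodDesc_comp_inr`, `coprodDesc_unique`, **`inl_comp_fst_add_inr_comp_snd = id`**, `prodMap_eq`.
* §5 **Hodge loci of a direct sum**: `isHodgeAt_prod_inl_iff` ∕ `_inr_iff` (`(m, 0)` is Hodge iff `m` is), `prod_form_toRat_inl ∕ _inr`,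
  **`hodgeLocusOfNormLe_subset_prod_left ∕ _right`**, `union_hodgeLocusOfNormLe_subset_prod`, and in weight `k = 2p` (positivity of `Q` on nonzero
  integral Hodge classes, `form_toRat_self_pos`) the EQUALITY **`hodgeLocusOfNormLe_prod_eq_union`**: `HL(D₁ ⊕ D₂; p, K) = HL(D₁; p, K) ∪ HL(D₂; p, K)`;
  determination loci: `setOf_exists_isHodgeAt_transport_prod_inl ∕ _inr`.

HONEST SCOPE: as for every `VHSData`, holomorphy ∕ transversality are not recorded; no categorical (`Preadditive` ∕ biproduct) instances are declared —
the statements are the explicit equations a consumer needs.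

## References

* [Deligne1970] P. Deligne, *Équations différentielles à points singuliers réguliers*, LNM 163 (1970), I.1.
* [DeligneHodgeII1971] P. Deligne, *Théorie de Hodge II*, Publ. Math. IHÉS 40 (1971), 2.1, Thm. 2.3.5, 2.1.15.
* [Schmid1973] W. Schmid, *Variation of Hodge structure: the singularities of the period mapping*, Invent. Math. 22 (1973), §2.
* [Griffiths1970] P. Griffiths, *Periods of integrals on algebraic manifolds III*, Publ. Math. IHÉS 38 (1970), §1.
* [VoisinHodgeI2002] C. Voisin, *Hodge Theory and Complex Algebraic Geometry I*, CUP (2002), §7.1.2 Def. 7.7, §7.3.1.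
* [CattaniDeligneKaplan1995] E. Cattani, P. Deligne, A. Kaplan, *On the locus of Hodge classes*, J. Amer. Math. Soc. 8 (1995), §1, Thm. 1.1.
-/

noncomputable section

open CategoryTheory
open scoped TensorProduct

namespace Literature.AlgebraicGeometry.Motives

namespace VHSData

variable {S : Type} [TopologicalSpace S] {k k₁ k₂ : ℤ}

/-! ## §1 Morphisms of VHS data form an abelian group -/

section Additive

variable (D₁ : VHSData S k₁) (D₂ : VHSData S k₂)

/-- The rationalization of the zero lattice map is zero. [cite: Schmid1973, §2] -/
theorem homRat_zero (s : S) : D₁.homRat D₂ s 0 = 0 :=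
  map_zero _

/-- The rationalization of `−f` is `−f_ℚ`. [cite: Schmid1973, §2] -/
theorem homRat_neg (s : S) (f : D₁.VZ.fiber s →ₗ[ℤ] D₂.VZ.fiber s) : D₁.homRat D₂ s (-f) = -D₁.homRat D₂ s f :=
  map_neg _ f

/-- The rationalization of `f − g` is `f_ℚ − g_ℚ`. [cite: Schmid1973, §2] -/
theorem homRat_sub (s : S) (f g : D₁.VZ.fiber s →ₗ[ℤ] D₂.VZ.fiber s) : D₁.homRat D₂ s (f - g) = D₁.homRat D₂ s f - D₁.homRat D₂ s g :=
  map_sub _ f g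

variable {D₁ D₂} {D D' D'' : VHSData S k}

/-- **The zero morphism `0 : D → D'`.** [cite: DeligneHodgeII1971, Thm. 2.3.5] [cite: Deligne1970, I.1] -/
def Hom.zero (D D' : VHSData S k) : Hom D D' :=
  Hom.ofFlat (fun _ => 0) (fun γ u => by rw [LinearMap.zero_apply, LinearMap.zero_apply, map_zero]) fun s p => by
    rw [homRat_zero, LinearMap.baseChange_zero, Submodule.map_zero]
    exact bot_le

/-- **The sum `φ + ψ` of two morphisms `D → D'`** (lattice maps `φ_s + ψ_s`; flat; Hodge since `(φ_s + ψ_s)_ℚ = (φ_s)_ℚ + (ψ_s)_ℚ` maps `F^p` into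
`F^p + F^p = F^p`). [cite: DeligneHodgeII1971, Thm. 2.3.5] [cite: Deligne1970, I.1] -/
def Hom.add (φ ψ : Hom D D') : Hom D D' :=
  Hom.ofFlat (fun s => φ.app s + ψ.app s)
    (fun γ u => by rw [LinearMap.add_apply, LinearMap.add_apply, map_add, φ.app_transport, ψ.app_transport]) fun s p => by
    rw [homRat_add, LinearMap.baseChange_add]
    exact (Submodule.map_add_le _ _ _).trans (sup_le (φ.map_F_le s p) (ψ.map_F_le s p))

/-- **The negative `−φ` of a morphism.** [cite: DeligneHodgeII1971, Thm. 2.3.5] [cite: Deligne1970, I.1] -/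
def Hom.neg (φ : Hom D D') : Hom D D' :=
  Hom.ofFlat (fun s => -φ.app s) (fun γ u => by rw [LinearMap.neg_apply, LinearMap.neg_apply, map_neg, φ.app_transport]) fun s p => by
    rw [homRat_neg, LinearMap.baseChange_neg, Submodule.map_neg]
    exact φ.map_F_le s p

/-- **The difference `φ − ψ` of two morphisms** (as `φ + (−ψ)`). [cite: DeligneHodgeII1971, Thm. 2.3.5] -/
def Hom.sub (φ ψ : Hom D D') : Hom D D' :=
  φ.add ψ.neg

/-- The zero morphism has zero lattice maps. [cite: DeligneHodgeII1971, Thm. 2.3.5] -/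
@[simp] theorem Hom.zero_app (s : S) : (Hom.zero D D').app s = 0 := rfl

/-- `(φ + ψ)_s = φ_s + ψ_s`. [cite: DeligneHodgeII1971, Thm. 2.3.5] -/
@[simp] theorem Hom.add_app (φ ψ : Hom D D') (s : S) : (φ.add ψ).app s = φ.app s + ψ.app s := rfl

/-- `(−φ)_s = −φ_s`. [cite: DeligneHodgeII1971, Thm. 2.3.5] -/
@[simp] theorem Hom.neg_app (φ : Hom D D') (s : S) : φ.neg.app s = -φ.app s := rfl

/-- `(φ − ψ)_s = φ_s − ψ_s`. [cite: DeligneHodgeII1971, Thm. 2.3.5] -/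
@[simp] theorem Hom.sub_app (φ ψ : Hom D D') (s : S) : (φ.sub ψ).app s = φ.app s - ψ.app s :=
  (sub_eq_add_neg (φ.app s) (ψ.app s)).symm

/-- `φ + ψ = ψ + φ`. [cite: DeligneHodgeII1971, Thm. 2.3.5] -/
theorem Hom.add_comm (φ ψ : Hom D D') : φ.add ψ = ψ.add φ :=
  Hom.ext_of_app _ _ fun s => _root_.add_comm (φ.app s) (ψ.app s)

/-- `(φ + ψ) + χ = φ + (ψ + χ)`. [cite: DeligneHodgeII1971, Thm. 2.3.5] -/
theorem Hom.add_assoc (φ ψ χ : Hom D D') : (φ.add ψ).add χ = φ.add (ψ.add χ) :=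
  Hom.ext_of_app _ _ fun s => _root_.add_assoc (φ.app s) (ψ.app s) (χ.app s)

/-- `0 + φ = φ`. [cite: DeligneHodgeII1971, Thm. 2.3.5] -/
theorem Hom.zero_add (φ : Hom D D') : (Hom.zero D D').add φ = φ :=
  Hom.ext_of_app _ _ fun s => _root_.zero_add (φ.app s)

/-- `φ + 0 = φ`. [cite: DeligneHodgeII1971, Thm. 2.3.5] -/
theorem Hom.add_zero (φ : Hom D D') : φ.add (Hom.zero D D') = φ :=
  Hom.ext_of_app _ _ fun s => _root_.add_zero (φ.app s)

/-- `−φ + φ = 0`. [cite: DeligneHodgeII1971, Thm. 2.3.5] -/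
theorem Hom.neg_add_cancel (φ : Hom D D') : φ.neg.add φ = Hom.zero D D' :=
  Hom.ext_of_app _ _ fun s => _root_.neg_add_cancel (φ.app s)

/-- `φ − φ = 0`. [cite: DeligneHodgeII1971, Thm. 2.3.5] -/
theorem Hom.sub_self (φ : Hom D D') : φ.sub φ = Hom.zero D D' :=
  Hom.ext_of_app _ _ fun s => by rw [Hom.sub_app, _root_.sub_self, Hom.zero_app]

/-- Composition is additive in the first (applied second) variable: `χ ∘ (φ + ψ) = χ ∘ φ + χ ∘ ψ`. [cite: DeligneHodgeII1971, Thm. 2.3.5] -/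
theorem Hom.comp_add (χ : Hom D' D'') (φ ψ : Hom D D') : χ.comp (φ.add ψ) = (χ.comp φ).add (χ.comp ψ) :=
  Hom.ext_of_app _ _ fun s => LinearMap.comp_add _ _ (χ.app s)

/-- Composition is additive in the second variable: `(φ + ψ) ∘ χ = φ ∘ χ + ψ ∘ χ`. [cite: DeligneHodgeII1971, Thm. 2.3.5] -/
theorem Hom.add_comp (φ ψ : Hom D' D'') (χ : Hom D D') : (φ.add ψ).comp χ = (φ.comp χ).add (ψ.comp χ) :=
  Hom.ext_of_app _ _ fun s => LinearMap.add_comp (χ.app s) _ _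

/-- `χ ∘ 0 = 0`. [cite: DeligneHodgeII1971, Thm. 2.3.5] -/
theorem Hom.comp_zero (χ : Hom D' D'') : χ.comp (Hom.zero D D') = Hom.zero D D'' :=
  Hom.ext_of_app _ _ fun s => LinearMap.comp_zero (χ.app s)

/-- `0 ∘ χ = 0`. [cite: DeligneHodgeII1971, Thm. 2.3.5] -/
theorem Hom.zero_comp (χ : Hom D D') : (Hom.zero D' D'').comp χ = Hom.zero D D'' :=
  Hom.ext_of_app _ _ fun s => LinearMap.zero_comp (χ.app s)

/-- `χ ∘ (−φ) = −(χ ∘ φ)`. [cite: DeligneHodgeII1971, Thm. 2.3.5] -/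
theorem Hom.comp_neg (χ : Hom D' D'') (φ : Hom D D') : χ.comp φ.neg = (χ.comp φ).neg :=
  Hom.ext_of_app _ _ fun s => LinearMap.comp_neg _ (χ.app s)

/-- `(−φ) ∘ χ = −(φ ∘ χ)`. [cite: DeligneHodgeII1971, Thm. 2.3.5] -/
theorem Hom.neg_comp (φ : Hom D' D'') (χ : Hom D D') : φ.neg.comp χ = (φ.comp χ).neg :=
  Hom.ext_of_app _ _ fun s => LinearMap.neg_comp (χ.app s) _

end Additive

/-! ## §2 Complexifications of `f × g`, `f ∘ pr₁`, `f ∘ pr₂` through `prodEquiv` -/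

section Complexification

variable {U V W : Type} [AddCommGroup U] [Module ℚ U] [AddCommGroup V] [Module ℚ V] [AddCommGroup W] [Module ℚ W]

/-- `prodEquiv ((f × g)_ℂ z) = (f_ℂ z, g_ℂ z)`. [folklore] -/
private theorem prodEquiv_baseChange_prod (f : U →ₗ[ℚ] V) (g : U →ₗ[ℚ] W) (z : ℂ ⊗[ℚ] U) :
    HodgeStructure.prodEquiv V W ((f.prod g).baseChange ℂ z) = (f.baseChange ℂ z, g.baseChange ℂ z) := by
  induction z using TensorProduct.induction_on with
  | zero => simp only [map_zero]; rfl
  | tmul c u => simp [HodgeStructure.prodEquiv]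
  | add x y hx hy => rw [map_add, map_add, hx, hy, map_add, map_add, Prod.mk_add_mk]

/-- `(f ∘ pr₁)_ℂ z = f_ℂ (prodEquiv z).1`. [folklore] -/
private theorem baseChange_comp_fst_apply (f : V →ₗ[ℚ] U) (z : ℂ ⊗[ℚ] (V × W)) :
    (f ∘ₗ LinearMap.fst ℚ V W).baseChange ℂ z = f.baseChange ℂ (HodgeStructure.prodEquiv V W z).1 := by
  induction z using TensorProduct.induction_on with
  | zero => simp only [map_zero, Prod.fst_zero]
  | tmul c v => simp [HodgeStructure.prodEquiv]
  | add x y hx hy => rw [map_add, map_add, hx, hy, Prod.fst_add, map_add]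

/-- `(f ∘ pr₂)_ℂ z = f_ℂ (prodEquiv z).2`. [folklore] -/
private theorem baseChange_comp_snd_apply (f : W →ₗ[ℚ] U) (z : ℂ ⊗[ℚ] (V × W)) :
    (f ∘ₗ LinearMap.snd ℚ V W).baseChange ℂ z = f.baseChange ℂ (HodgeStructure.prodEquiv V W z).2 := by
  induction z using TensorProduct.induction_on with
  | zero => simp only [map_zero, Prod.snd_zero]
  | tmul c v => simp [HodgeStructure.prodEquiv]
  | add x y hx hy => rw [map_add, map_add, hx, hy, Prod.snd_add, map_add]

/-- `(pr₁)_ℂ z = (prodEquiv z).1`. [folklore] -/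
private theorem baseChange_fst_apply (z : ℂ ⊗[ℚ] (V × W)) :
    (LinearMap.fst ℚ V W).baseChange ℂ z = (HodgeStructure.prodEquiv V W z).1 := by
  induction z using TensorProduct.induction_on with
  | zero => simp only [map_zero, Prod.fst_zero]
  | tmul c v => simp [HodgeStructure.prodEquiv]
  | add x y hx hy => rw [map_add, map_add, hx, hy, Prod.fst_add]

/-- `(pr₂)_ℂ z = (prodEquiv z).2`. [folklore] -/
private theorem baseChange_snd_apply (z : ℂ ⊗[ℚ] (V × W)) :
    (LinearMap.snd ℚ V W).baseChange ℂ z = (HodgeStructure.prodEquiv V W z).2 := by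
  induction z using TensorProduct.induction_on with
  | zero => simp only [map_zero, Prod.snd_zero]
  | tmul c v => simp [HodgeStructure.prodEquiv]
  | add x y hx hy => rw [map_add, map_add, hx, hy, Prod.snd_add]

/-- Membership form of `baseChange_fst_apply`. [folklore] -/
private theorem fst_baseChange_mem {F : Submodule ℂ (ℂ ⊗[ℚ] V)} {z : ℂ ⊗[ℚ] (V × W)} (h : (HodgeStructure.prodEquiv V W z).1 ∈ F) :
    (LinearMap.fst ℚ V W).baseChange ℂ z ∈ F := by
  rwa [baseChange_fst_apply]

/-- Membership form of `baseChange_snd_apply`. [folklore] -/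
private theorem snd_baseChange_mem {F : Submodule ℂ (ℂ ⊗[ℚ] W)} {z : ℂ ⊗[ℚ] (V × W)} (h : (HodgeStructure.prodEquiv V W z).2 ∈ F) :
    (LinearMap.snd ℚ V W).baseChange ℂ z ∈ F := by
  rwa [baseChange_snd_apply]

/-- `(f × g)_ℂ z` has components in `F₁`, `F₂` as soon as `f_ℂ z ∈ F₁`, `g_ℂ z ∈ F₂`. [folklore] -/
private theorem prod_baseChange_mem {F₁ : Submodule ℂ (ℂ ⊗[ℚ] V)} {F₂ : Submodule ℂ (ℂ ⊗[ℚ] W)} (f : U →ₗ[ℚ] V) (g : U →ₗ[ℚ] W)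
    {z : ℂ ⊗[ℚ] U} (h₁ : f.baseChange ℂ z ∈ F₁) (h₂ : g.baseChange ℂ z ∈ F₂) :
    (HodgeStructure.prodEquiv V W ((f.prod g).baseChange ℂ z)).1 ∈ F₁ ∧ (HodgeStructure.prodEquiv V W ((f.prod g).baseChange ℂ z)).2 ∈ F₂ := by
  rw [prodEquiv_baseChange_prod]
  exact ⟨h₁, h₂⟩

/-- `⟨f, g⟩_ℂ z ∈ F` as soon as `f_ℂ z₁ ∈ F` and `g_ℂ z₂ ∈ F` (`(z₁, z₂) = prodEquiv z`). [folklore] -/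
private theorem coprod_baseChange_mem {F : Submodule ℂ (ℂ ⊗[ℚ] U)} (f : V →ₗ[ℚ] U) (g : W →ₗ[ℚ] U) {z : ℂ ⊗[ℚ] (V × W)}
    (h₁ : f.baseChange ℂ (HodgeStructure.prodEquiv V W z).1 ∈ F) (h₂ : g.baseChange ℂ (HodgeStructure.prodEquiv V W z).2 ∈ F) :
    (f.coprod g).baseChange ℂ z ∈ F := by
  rw [LinearMap.coprod, LinearMap.baseChange_add, LinearMap.add_apply, baseChange_comp_fst_apply, baseChange_comp_snd_apply]
  exact Submodule.add_mem _ h₁ h₂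

/-- `(f × g)_ℂ z` (for `f : V → V'`, `g : W → W'`) has components in `F₁'`, `F₂'` as soon as `f_ℂ z₁ ∈ F₁'`, `g_ℂ z₂ ∈ F₂'`. [folklore] -/
private theorem prodMap_baseChange_mem {V' W' : Type} [AddCommGroup V'] [Module ℚ V'] [AddCommGroup W'] [Module ℚ W']
    {F₁' : Submodule ℂ (ℂ ⊗[ℚ] V')} {F₂' : Submodule ℂ (ℂ ⊗[ℚ] W')} (f : V →ₗ[ℚ] V') (g : W →ₗ[ℚ] W') {z : ℂ ⊗[ℚ] (V × W)}
    (h₁ : f.baseChange ℂ (HodgeStructure.prodEquiv V W z).1 ∈ F₁') (h₂ : g.baseChange ℂ (HodgeStructure.prodEquiv V W z).2 ∈ F₂') :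
    (HodgeStructure.prodEquiv V' W' ((f.prodMap g).baseChange ℂ z)).1 ∈ F₁' ∧
      (HodgeStructure.prodEquiv V' W' ((f.prodMap g).baseChange ℂ z)).2 ∈ F₂' := by
  rw [LinearMap.prodMap, prodEquiv_baseChange_prod, baseChange_comp_fst_apply, baseChange_comp_snd_apply]
  exact ⟨h₁, h₂⟩

end Complexification

/-! ## §3 The biproduct structure maps of `D₁ ⊕ D₂` -/

section Biproduct

variable (D₁ D₂ : VHSData S k) {D D₁' D₂' : VHSData S k}

/-- Membership in `F^p` of `D₁ ⊕ D₂` is componentwise (the tree's `HodgeStructure.prod`, by `rfl`). [cite: DeligneHodgeII1971, 2.1] -/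
theorem mem_prod_hodge_F_iff (s : S) (p : ℤ) (z : ℂ ⊗[ℚ] (D₁.V.fiber s × D₂.V.fiber s)) :
    z ∈ ((D₁.prod D₂).hodge s).F p ↔
      (HodgeStructure.prodEquiv (D₁.V.fiber s) (D₂.V.fiber s) z).1 ∈ (D₁.hodge s).F p ∧
        (HodgeStructure.prodEquiv (D₁.V.fiber s) (D₂.V.fiber s) z).2 ∈ (D₂.hodge s).F p :=
  Iff.rfl

/-- The rationalization of the first projection of lattices is the first projection. [cite: Schmid1973, §2] -/
theorem homRat_fst (s : S) :
    (D₁.prod D₂).homRat D₁ s (LinearMap.fst ℤ (D₁.VZ.fiber s) (D₂.VZ.fiber s)) = LinearMap.fst ℚ (D₁.V.fiber s) (D₂.V.fiber s) :=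
  ((D₁.prod D₂).homRat_unique D₁ s _ _ fun m => by obtain ⟨m₁, m₂⟩ := m; rfl).symm

/-- The rationalization of the second projection of lattices is the second projection. [cite: Schmid1973, §2] -/
theorem homRat_snd (s : S) :
    (D₁.prod D₂).homRat D₂ s (LinearMap.snd ℤ (D₁.VZ.fiber s) (D₂.VZ.fiber s)) = LinearMap.snd ℚ (D₁.V.fiber s) (D₂.V.fiber s) :=
  ((D₁.prod D₂).homRat_unique D₂ s _ _ fun m => by obtain ⟨m₁, m₂⟩ := m; rfl).symm

variable {D₁ D₂}

/-- The rationalization of `(φ_s, ψ_s) : V_ℤ,s → V₁,ℤ,s × V₂,ℤ,s` is `((φ_s)_ℚ, (ψ_s)_ℚ)`. [cite: Schmid1973, §2] -/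
theorem homRat_prod (φ : Hom D D₁) (ψ : Hom D D₂) (s : S) :
    D.homRat (D₁.prod D₂) s ((φ.app s).prod (ψ.app s)) = (φ.appRat s).prod (ψ.appRat s) :=
  (D.homRat_unique (D₁.prod D₂) s _ _ fun m => Prod.ext (φ.appRat_toRat s m) (ψ.appRat_toRat s m)).symm

/-- The rationalization of `φ_s ∘ pr₁ + ψ_s ∘ pr₂ : V₁,ℤ,s × V₂,ℤ,s → V_ℤ,s` is `(φ_s)_ℚ ∘ pr₁ + (ψ_s)_ℚ ∘ pr₂`. [cite: Schmid1973, §2] -/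
theorem homRat_coprod (φ : Hom D₁ D) (ψ : Hom D₂ D) (s : S) :
    (D₁.prod D₂).homRat D s ((φ.app s).coprod (ψ.app s)) = (φ.appRat s).coprod (ψ.appRat s) :=
  ((D₁.prod D₂).homRat_unique D s _ _ fun m => by
    obtain ⟨m₁, m₂⟩ := m
    change φ.appRat s (D₁.toRat s m₁) + ψ.appRat s (D₂.toRat s m₂) = D.toRat s (φ.app s m₁ + ψ.app s m₂)
    rw [φ.appRat_toRat, ψ.appRat_toRat, map_add]).symm

/-- The rationalization of `φ_s × ψ_s` is `(φ_s)_ℚ × (ψ_s)_ℚ`. [cite: Schmid1973, §2] -/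
theorem homRat_prodMap (φ : Hom D₁ D₁') (ψ : Hom D₂ D₂') (s : S) :
    (D₁.prod D₂).homRat (D₁'.prod D₂') s ((φ.app s).prodMap (ψ.app s)) = (φ.appRat s).prodMap (ψ.appRat s) :=
  ((D₁.prod D₂).homRat_unique (D₁'.prod D₂') s _ _ fun m => by
    obtain ⟨m₁, m₂⟩ := m
    exact Prod.ext (φ.appRat_toRat s m₁) (ψ.appRat_toRat s m₂)).symm

variable (D₁ D₂)

/-- **The first projection `pr₁ : D₁ ⊕ D₂ → D₁` is a morphism** (Deligne, Hodge II 2.1: `pr₁(F^p(H₁ ⊕ H₂)) ⊆ F^p H₁`). [cite: DeligneHodgeII1971, 2.1]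
[cite: Schmid1973, §2] -/
def Hom.fst : Hom (D₁.prod D₂) D₁ :=
  Hom.ofFlat (fun s => LinearMap.fst ℤ (D₁.VZ.fiber s) (D₂.VZ.fiber s)) (fun γ m => by obtain ⟨m₁, m₂⟩ := m; rfl) fun s p => by
    rw [homRat_fst]
    rintro _ ⟨z, hz, rfl⟩
    exact fst_baseChange_mem ((mem_prod_hodge_F_iff D₁ D₂ s p z).1 hz).1

/-- **The second projection `pr₂ : D₁ ⊕ D₂ → D₂` is a morphism.** [cite: DeligneHodgeII1971, 2.1] [cite: Schmid1973, §2] -/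
def Hom.snd : Hom (D₁.prod D₂) D₂ :=
  Hom.ofFlat (fun s => LinearMap.snd ℤ (D₁.VZ.fiber s) (D₂.VZ.fiber s)) (fun γ m => by obtain ⟨m₁, m₂⟩ := m; rfl) fun s p => by
    rw [homRat_snd]
    rintro _ ⟨z, hz, rfl⟩
    exact snd_baseChange_mem ((mem_prod_hodge_F_iff D₁ D₂ s p z).1 hz).2

variable {D₁ D₂}

/-- **The universal morphism `(φ, ψ) : D → D₁ ⊕ D₂`** of two morphisms `φ : D → D₁`, `ψ : D → D₂` (lattice maps `u ↦ (φ_s u, ψ_s u)`).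
[cite: DeligneHodgeII1971, 2.1 and Thm. 2.3.5] [cite: Deligne1970, I.1] -/
def Hom.prodLift (φ : Hom D D₁) (ψ : Hom D D₂) : Hom D (D₁.prod D₂) :=
  Hom.ofFlat (fun s => (φ.app s).prod (ψ.app s))
    (fun γ u => Prod.ext (φ.app_transport γ u) (ψ.app_transport γ u)) fun s p => by
    rw [homRat_prod]
    rintro _ ⟨z, hz, rfl⟩
    exact (mem_prod_hodge_F_iff D₁ D₂ s p _).2
      (prod_baseChange_mem _ _ ((φ.hodgeHom s).map_F_le p ⟨z, hz, rfl⟩) ((ψ.hodgeHom s).map_F_le p ⟨z, hz, rfl⟩))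

/-- **The injection `ι₁ : D₁ → D₁ ⊕ D₂`, `u ↦ (u, 0)`** (= `(id, 0)`). [cite: DeligneHodgeII1971, 2.1] [cite: Deligne1970, I.1] -/
def Hom.inl (D₁ D₂ : VHSData S k) : Hom D₁ (D₁.prod D₂) :=
  (Hom.id D₁).prodLift (Hom.zero D₁ D₂)

/-- **The injection `ι₂ : D₂ → D₁ ⊕ D₂`, `u ↦ (0, u)`** (= `(0, id)`). [cite: DeligneHodgeII1971, 2.1] [cite: Deligne1970, I.1] -/
def Hom.inr (D₁ D₂ : VHSData S k) : Hom D₂ (D₁.prod D₂) :=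
  (Hom.zero D₂ D₁).prodLift (Hom.id D₂)

/-- **The universal morphism `⟨φ, ψ⟩ : D₁ ⊕ D₂ → D`** of two morphisms `φ : D₁ → D`, `ψ : D₂ → D` (lattice maps `(u₁, u₂) ↦ φ_s u₁ + ψ_s u₂`).
[cite: DeligneHodgeII1971, 2.1 and Thm. 2.3.5] [cite: Deligne1970, I.1] -/
def Hom.coprodDesc (φ : Hom D₁ D) (ψ : Hom D₂ D) : Hom (D₁.prod D₂) D :=
  Hom.ofFlat (fun s => (φ.app s).coprod (ψ.app s))
    (fun γ m => by
      obtain ⟨m₁, m₂⟩ := m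
      change φ.app _ (D₁.VZ.transport γ m₁) + ψ.app _ (D₂.VZ.transport γ m₂) = D.VZ.transport γ (φ.app _ m₁ + ψ.app _ m₂)
      rw [φ.app_transport, ψ.app_transport, map_add])
    fun s p => by
    rw [homRat_coprod]
    rintro _ ⟨z, hz, rfl⟩
    obtain ⟨h₁, h₂⟩ := (mem_prod_hodge_F_iff D₁ D₂ s p z).1 hz
    exact coprod_baseChange_mem _ _ ((φ.hodgeHom s).map_F_le p ⟨_, h₁, rfl⟩) ((ψ.hodgeHom s).map_F_le p ⟨_, h₂, rfl⟩)

/-- **The direct sum `φ ⊕ ψ : D₁ ⊕ D₂ → D₁' ⊕ D₂'` of two morphisms** (lattice maps `(u₁, u₂) ↦ (φ_s u₁, ψ_s u₂)`). [cite: DeligneHodgeII1971, 2.1]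
[cite: Deligne1970, I.1] -/
def Hom.prodMap (φ : Hom D₁ D₁') (ψ : Hom D₂ D₂') : Hom (D₁.prod D₂) (D₁'.prod D₂') :=
  Hom.ofFlat (fun s => (φ.app s).prodMap (ψ.app s))
    (fun γ m => by
      obtain ⟨m₁, m₂⟩ := m
      exact Prod.ext (φ.app_transport γ m₁) (ψ.app_transport γ m₂))
    fun s p => by
    rw [homRat_prodMap]
    rintro _ ⟨z, hz, rfl⟩
    obtain ⟨h₁, h₂⟩ := (mem_prod_hodge_F_iff D₁ D₂ s p z).1 hz
    exact (mem_prod_hodge_F_iff D₁' D₂' s p _).2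
      (prodMap_baseChange_mem _ _ ((φ.hodgeHom s).map_F_le p ⟨_, h₁, rfl⟩) ((ψ.hodgeHom s).map_F_le p ⟨_, h₂, rfl⟩))

/-- `pr₁` on lattices is `LinearMap.fst`. [cite: DeligneHodgeII1971, 2.1] -/
@[simp] theorem Hom.fst_app (s : S) : (Hom.fst D₁ D₂).app s = LinearMap.fst ℤ (D₁.VZ.fiber s) (D₂.VZ.fiber s) := rfl

/-- `pr₂` on lattices is `LinearMap.snd`. [cite: DeligneHodgeII1971, 2.1] -/
@[simp] theorem Hom.snd_app (s : S) : (Hom.snd D₁ D₂).app s = LinearMap.snd ℤ (D₁.VZ.fiber s) (D₂.VZ.fiber s) := rfl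

/-- `(φ, ψ)` on lattices is `LinearMap.prod`. [cite: DeligneHodgeII1971, 2.1] -/
@[simp] theorem Hom.prodLift_app (φ : Hom D D₁) (ψ : Hom D D₂) (s : S) : (φ.prodLift ψ).app s = (φ.app s).prod (ψ.app s) := rfl

/-- `ι₁` on lattices is `LinearMap.inl`. [cite: DeligneHodgeII1971, 2.1] -/
@[simp] theorem Hom.inl_app (s : S) : (Hom.inl D₁ D₂).app s = LinearMap.inl ℤ (D₁.VZ.fiber s) (D₂.VZ.fiber s) := rfl

/-- `ι₂` on lattices is `LinearMap.inr`. [cite: DeligneHodgeII1971, 2.1] -/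
@[simp] theorem Hom.inr_app (s : S) : (Hom.inr D₁ D₂).app s = LinearMap.inr ℤ (D₁.VZ.fiber s) (D₂.VZ.fiber s) := rfl

/-- `ι₁ u = (u, 0)`. [cite: DeligneHodgeII1971, 2.1] -/
theorem Hom.inl_app_apply (s : S) (u : D₁.VZ.fiber s) : (Hom.inl D₁ D₂).app s u = ((u, 0) : D₁.VZ.fiber s × D₂.VZ.fiber s) := rfl

/-- `ι₂ u = (0, u)`. [cite: DeligneHodgeII1971, 2.1] -/
theorem Hom.inr_app_apply (s : S) (u : D₂.VZ.fiber s) : (Hom.inr D₁ D₂).app s u = ((0, u) : D₁.VZ.fiber s × D₂.VZ.fiber s) := rfl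

/-- `⟨φ, ψ⟩` on lattices is `LinearMap.coprod`. [cite: DeligneHodgeII1971, 2.1] -/
@[simp] theorem Hom.coprodDesc_app (φ : Hom D₁ D) (ψ : Hom D₂ D) (s : S) : (φ.coprodDesc ψ).app s = (φ.app s).coprod (ψ.app s) := rfl

/-- `φ ⊕ ψ` on lattices is `LinearMap.prodMap`. [cite: DeligneHodgeII1971, 2.1] -/
@[simp] theorem Hom.prodMap_app (φ : Hom D₁ D₁') (ψ : Hom D₂ D₂') (s : S) : (φ.prodMap ψ).app s = (φ.app s).prodMap (ψ.app s) := rfl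

/-! ## §4 Biproduct identities -/

/-- `pr₁ ∘ ι₁ = id`. [cite: DeligneHodgeII1971, 2.1 and Thm. 2.3.5] -/
theorem Hom.fst_comp_inl : (Hom.fst D₁ D₂).comp (Hom.inl D₁ D₂) = Hom.id D₁ :=
  Hom.ext_of_app _ _ fun _ => rfl

/-- `pr₂ ∘ ι₂ = id`. [cite: DeligneHodgeII1971, 2.1 and Thm. 2.3.5] -/
theorem Hom.snd_comp_inr : (Hom.snd D₁ D₂).comp (Hom.inr D₁ D₂) = Hom.id D₂ :=
  Hom.ext_of_app _ _ fun _ => rfl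

/-- `pr₁ ∘ ι₂ = 0`. [cite: DeligneHodgeII1971, 2.1 and Thm. 2.3.5] -/
theorem Hom.fst_comp_inr : (Hom.fst D₁ D₂).comp (Hom.inr D₁ D₂) = Hom.zero D₂ D₁ :=
  Hom.ext_of_app _ _ fun _ => rfl

/-- `pr₂ ∘ ι₁ = 0`. [cite: DeligneHodgeII1971, 2.1 and Thm. 2.3.5] -/
theorem Hom.snd_comp_inl : (Hom.snd D₁ D₂).comp (Hom.inl D₁ D₂) = Hom.zero D₁ D₂ :=
  Hom.ext_of_app _ _ fun _ => rfl

/-- `pr₁ ∘ (φ, ψ) = φ`. [cite: DeligneHodgeII1971, 2.1 and Thm. 2.3.5] -/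
theorem Hom.fst_comp_prodLift (φ : Hom D D₁) (ψ : Hom D D₂) : (Hom.fst D₁ D₂).comp (φ.prodLift ψ) = φ :=
  Hom.ext_of_app _ _ fun _ => rfl

/-- `pr₂ ∘ (φ, ψ) = ψ`. [cite: DeligneHodgeII1971, 2.1 and Thm. 2.3.5] -/
theorem Hom.snd_comp_prodLift (φ : Hom D D₁) (ψ : Hom D D₂) : (Hom.snd D₁ D₂).comp (φ.prodLift ψ) = ψ :=
  Hom.ext_of_app _ _ fun _ => rfl

/-- **Uniqueness of `(φ, ψ)`**: a morphism `χ : D → D₁ ⊕ D₂` with `pr₁ ∘ χ = φ` and `pr₂ ∘ χ = ψ` is `(φ, ψ)`. [cite: DeligneHodgeII1971, Thm. 2.3.5] -/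
theorem Hom.prodLift_unique (φ : Hom D D₁) (ψ : Hom D D₂) (χ : Hom D (D₁.prod D₂)) (h₁ : (Hom.fst D₁ D₂).comp χ = φ)
    (h₂ : (Hom.snd D₁ D₂).comp χ = ψ) : χ = φ.prodLift ψ := by
  subst h₁ h₂
  exact Hom.ext_of_app _ _ fun _ => rfl

/-- `⟨φ, ψ⟩ ∘ ι₁ = φ`. [cite: DeligneHodgeII1971, 2.1 and Thm. 2.3.5] -/
theorem Hom.coprodDesc_comp_inl (φ : Hom D₁ D) (ψ : Hom D₂ D) : (φ.coprodDesc ψ).comp (Hom.inl D₁ D₂) = φ :=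
  Hom.ext_of_app _ _ fun s => LinearMap.ext fun u => by
    change φ.app s u + ψ.app s 0 = φ.app s u
    rw [map_zero, _root_.add_zero]

/-- `⟨φ, ψ⟩ ∘ ι₂ = ψ`. [cite: DeligneHodgeII1971, 2.1 and Thm. 2.3.5] -/
theorem Hom.coprodDesc_comp_inr (φ : Hom D₁ D) (ψ : Hom D₂ D) : (φ.coprodDesc ψ).comp (Hom.inr D₁ D₂) = ψ :=
  Hom.ext_of_app _ _ fun s => LinearMap.ext fun u => by
    change φ.app s 0 + ψ.app s u = ψ.app s u
    rw [map_zero, _root_.zero_add]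

/-- **Uniqueness of `⟨φ, ψ⟩`**: a morphism `χ : D₁ ⊕ D₂ → D` with `χ ∘ ι₁ = φ` and `χ ∘ ι₂ = ψ` is `⟨φ, ψ⟩`. [cite: DeligneHodgeII1971, Thm. 2.3.5] -/
theorem Hom.coprodDesc_unique (φ : Hom D₁ D) (ψ : Hom D₂ D) (χ : Hom (D₁.prod D₂) D) (h₁ : χ.comp (Hom.inl D₁ D₂) = φ)
    (h₂ : χ.comp (Hom.inr D₁ D₂) = ψ) : χ = φ.coprodDesc ψ := by
  subst h₁ h₂
  refine Hom.ext_of_app _ _ fun s => LinearMap.ext fun m => ?_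
  obtain ⟨m₁, m₂⟩ := m
  have hm : ((m₁, m₂) : D₁.VZ.fiber s × D₂.VZ.fiber s) =
      LinearMap.inl ℤ (D₁.VZ.fiber s) (D₂.VZ.fiber s) m₁ + LinearMap.inr ℤ (D₁.VZ.fiber s) (D₂.VZ.fiber s) m₂ :=
    Prod.ext (_root_.add_zero m₁).symm (_root_.zero_add m₂).symm
  calc χ.app s (m₁, m₂)
      = χ.app s (LinearMap.inl ℤ (D₁.VZ.fiber s) (D₂.VZ.fiber s) m₁ + LinearMap.inr ℤ (D₁.VZ.fiber s) (D₂.VZ.fiber s) m₂) :=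
        congrArg (χ.app s) hm
    _ = χ.app s (LinearMap.inl ℤ (D₁.VZ.fiber s) (D₂.VZ.fiber s) m₁) + χ.app s (LinearMap.inr ℤ (D₁.VZ.fiber s) (D₂.VZ.fiber s) m₂) :=
        map_add _ _ _
    _ = _ := rfl

/-- **`ι₁ ∘ pr₁ + ι₂ ∘ pr₂ = id`** on `D₁ ⊕ D₂`. [cite: DeligneHodgeII1971, 2.1 and Thm. 2.3.5] -/
theorem Hom.inl_comp_fst_add_inr_comp_snd :
    ((Hom.inl D₁ D₂).comp (Hom.fst D₁ D₂)).add ((Hom.inr D₁ D₂).comp (Hom.snd D₁ D₂)) = Hom.id (D₁.prod D₂) :=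
  Hom.ext_of_app _ _ fun s => LinearMap.ext fun m => by
    obtain ⟨m₁, m₂⟩ := m
    exact Prod.ext (_root_.add_zero m₁) (_root_.zero_add m₂)

/-- `φ ⊕ ψ = (φ ∘ pr₁, ψ ∘ pr₂)`. [cite: DeligneHodgeII1971, 2.1] -/
theorem Hom.prodMap_eq (φ : Hom D₁ D₁') (ψ : Hom D₂ D₂') :
    φ.prodMap ψ = (φ.comp (Hom.fst D₁ D₂)).prodLift (ψ.comp (Hom.snd D₁ D₂)) :=
  Hom.ext_of_app _ _ fun _ => rfl

/-- `φ ⊕ ψ = ι₁ ∘ φ ∘ pr₁ + ι₂ ∘ ψ ∘ pr₂`. [cite: DeligneHodgeII1971, 2.1] -/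
theorem Hom.prodMap_eq_add (φ : Hom D₁ D₁') (ψ : Hom D₂ D₂') :
    φ.prodMap ψ = ((Hom.inl D₁' D₂').comp (φ.comp (Hom.fst D₁ D₂))).add ((Hom.inr D₁' D₂').comp (ψ.comp (Hom.snd D₁ D₂))) :=
  Hom.ext_of_app _ _ fun s => LinearMap.ext fun m => by
    obtain ⟨m₁, m₂⟩ := m
    exact Prod.ext (_root_.add_zero _).symm (_root_.zero_add _).symm

/-- `id ⊕ id = id`. [cite: DeligneHodgeII1971, 2.1] -/
theorem Hom.prodMap_id : (Hom.id D₁).prodMap (Hom.id D₂) = Hom.id (D₁.prod D₂) :=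
  Hom.ext_of_app _ _ fun _ => LinearMap.ext fun m => by obtain ⟨m₁, m₂⟩ := m; rfl

/-- `(φ' ⊕ ψ') ∘ (φ ⊕ ψ) = (φ' ∘ φ) ⊕ (ψ' ∘ ψ)`. [cite: DeligneHodgeII1971, 2.1] -/
theorem Hom.prodMap_comp_prodMap {D₁'' D₂'' : VHSData S k} (φ' : Hom D₁' D₁'') (ψ' : Hom D₂' D₂'') (φ : Hom D₁ D₁') (ψ : Hom D₂ D₂') :
    (φ'.prodMap ψ').comp (φ.prodMap ψ) = (φ'.comp φ).prodMap (ψ'.comp ψ) :=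
  Hom.ext_of_app _ _ fun _ => LinearMap.ext fun m => by obtain ⟨m₁, m₂⟩ := m; rfl

end Biproduct

/-! ## §5 The Hodge loci of `D₁ ⊕ D₂` are the unions of the Hodge loci of the summands -/

section Loci

variable (D₁ D₂ : VHSData S k)

/-- `(m, 0)` is an integral Hodge class of `D₁ ⊕ D₂` of level `p` iff `m` is one of `D₁`. [cite: DeligneHodgeII1971, 2.1] [cite: CattaniDeligneKaplan1995, §1] -/
theorem isHodgeAt_prod_inl_iff (s : S) (p : ℤ) (m : D₁.VZ.fiber s) :
    (D₁.prod D₂).IsHodgeAt s p ((m, 0) : D₁.VZ.fiber s × D₂.VZ.fiber s) ↔ D₁.IsHodgeAt s p m := by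
  rw [isHodgeAt_prod_iff]
  exact ⟨fun h => h.1, fun h => ⟨h, D₂.isHodgeAt_zero s p⟩⟩

/-- `(0, m)` is an integral Hodge class of `D₁ ⊕ D₂` of level `p` iff `m` is one of `D₂`. [cite: DeligneHodgeII1971, 2.1] [cite: CattaniDeligneKaplan1995, §1] -/
theorem isHodgeAt_prod_inr_iff (s : S) (p : ℤ) (m : D₂.VZ.fiber s) :
    (D₁.prod D₂).IsHodgeAt s p ((0, m) : D₁.VZ.fiber s × D₂.VZ.fiber s) ↔ D₂.IsHodgeAt s p m := by
  rw [isHodgeAt_prod_iff]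
  exact ⟨fun h => h.2, fun h => ⟨D₁.isHodgeAt_zero s p, h⟩⟩

/-- `Q((m, 0), (m, 0)) = Q₁(m, m)`. [cite: DeligneHodgeII1971, 2.1.15] -/
theorem prod_form_toRat_inl (s : S) (m : D₁.VZ.fiber s) :
    ((D₁.prod D₂).form s).form ((D₁.prod D₂).toRat s ((m, 0) : D₁.VZ.fiber s × D₂.VZ.fiber s))
      ((D₁.prod D₂).toRat s ((m, 0) : D₁.VZ.fiber s × D₂.VZ.fiber s)) = (D₁.form s).form (D₁.toRat s m) (D₁.toRat s m) := by
  rw [prod_toRat_apply, prod_form_form, map_zero, LinearMap.map_zero₂, _root_.add_zero]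

/-- `Q((0, m), (0, m)) = Q₂(m, m)`. [cite: DeligneHodgeII1971, 2.1.15] -/
theorem prod_form_toRat_inr (s : S) (m : D₂.VZ.fiber s) :
    ((D₁.prod D₂).form s).form ((D₁.prod D₂).toRat s ((0, m) : D₁.VZ.fiber s × D₂.VZ.fiber s))
      ((D₁.prod D₂).toRat s ((0, m) : D₁.VZ.fiber s × D₂.VZ.fiber s)) = (D₂.form s).form (D₂.toRat s m) (D₂.toRat s m) := by
  rw [prod_toRat_apply, prod_form_form, map_zero, LinearMap.map_zero₂, _root_.zero_add]

/-- **`HL(D₁; p, K) ⊆ HL(D₁ ⊕ D₂; p, K)`**: a nonzero integral Hodge class `m` of `D₁` with `Q₁(m, m) ≤ K` gives the nonzero integral Hodge class `(m, 0)`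
of `D₁ ⊕ D₂` with the same self-intersection. [cite: CattaniDeligneKaplan1995, §1, Thm. 1.1] [cite: DeligneHodgeII1971, 2.1] -/
theorem hodgeLocusOfNormLe_subset_prod_left (p K : ℤ) : D₁.hodgeLocusOfNormLe p K ⊆ (D₁.prod D₂).hodgeLocusOfNormLe p K := by
  rintro s ⟨m, hm0, hm, hK⟩
  refine ⟨((m, 0) : D₁.VZ.fiber s × D₂.VZ.fiber s), fun h => hm0 (Prod.mk.inj h).1, (isHodgeAt_prod_inl_iff D₁ D₂ s p m).2 hm, ?_⟩
  rwa [prod_form_toRat_inl]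

/-- **`HL(D₂; p, K) ⊆ HL(D₁ ⊕ D₂; p, K)`.** [cite: CattaniDeligneKaplan1995, §1, Thm. 1.1] [cite: DeligneHodgeII1971, 2.1] -/
theorem hodgeLocusOfNormLe_subset_prod_right (p K : ℤ) : D₂.hodgeLocusOfNormLe p K ⊆ (D₁.prod D₂).hodgeLocusOfNormLe p K := by
  rintro s ⟨m, hm0, hm, hK⟩
  refine ⟨((0, m) : D₁.VZ.fiber s × D₂.VZ.fiber s), fun h => hm0 (Prod.mk.inj h).2, (isHodgeAt_prod_inr_iff D₁ D₂ s p m).2 hm, ?_⟩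
  rwa [prod_form_toRat_inr]

/-- `HL(D₁; p, K) ∪ HL(D₂; p, K) ⊆ HL(D₁ ⊕ D₂; p, K)`. [cite: CattaniDeligneKaplan1995, §1, Thm. 1.1] -/
theorem union_hodgeLocusOfNormLe_subset_prod (p K : ℤ) :
    D₁.hodgeLocusOfNormLe p K ∪ D₂.hodgeLocusOfNormLe p K ⊆ (D₁.prod D₂).hodgeLocusOfNormLe p K :=
  Set.union_subset (hodgeLocusOfNormLe_subset_prod_left D₁ D₂ p K) (hodgeLocusOfNormLe_subset_prod_right D₁ D₂ p K)

variable {D₁} in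
/-- **In weight `k = 2p` the polarization is positive on nonzero integral Hodge classes of level `p`**: `Q_s(u, u) > 0` (the tree's
`Polarization.form_self_pos_of_mem_hodgeClasses` on `toRat u ≠ 0`, `toRat` being injective). [cite: VoisinHodgeI2002, §7.1.2 Def. 7.7] [cite: CattaniDeligneKaplan1995, §1] -/
theorem form_toRat_self_pos {p : ℤ} (hp : p + p = k) {s : S} {u : D₁.VZ.fiber s} (hu : D₁.IsHodgeAt s p u) (hu0 : u ≠ 0) :
    0 < (D₁.form s).form (D₁.toRat s u) (D₁.toRat s u) :=
  (D₁.form s).form_self_pos_of_mem_hodgeClasses hp hu fun h => hu0 (D₁.toRat_injective_holds s (by rw [h, map_zero]))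

variable {D₁} in
/-- In weight `k = 2p`, `Q_s(u, u) ≥ 0` for every integral Hodge class `u` of level `p`. [cite: VoisinHodgeI2002, §7.1.2 Def. 7.7] -/
theorem form_toRat_self_nonneg {p : ℤ} (hp : p + p = k) {s : S} {u : D₁.VZ.fiber s} (hu : D₁.IsHodgeAt s p u) :
    0 ≤ (D₁.form s).form (D₁.toRat s u) (D₁.toRat s u) := by
  by_cases hu0 : u = 0
  · rw [hu0, map_zero, LinearMap.map_zero₂]
  · exact (form_toRat_self_pos hp hu hu0).le

/-- **The Hodge locus of a direct sum is the union of the Hodge loci of the summands** (weight `k = 2p`): a nonzero integral Hodge class `(u₁, u₂)` of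
`D₁ ⊕ D₂` with `Q₁(u₁, u₁) + Q₂(u₂, u₂) ≤ K` has `u₁ ≠ 0` or `u₂ ≠ 0`, both components Hodge, and both self-intersections `≥ 0`, so one of them is a
nonzero Hodge class of self-intersection `≤ K`. [cite: CattaniDeligneKaplan1995, §1, Thm. 1.1] [cite: VoisinHodgeI2002, §7.1.2 Def. 7.7] [cite: DeligneHodgeII1971, 2.1] -/
theorem hodgeLocusOfNormLe_prod_eq_union {p : ℤ} (hp : p + p = k) (K : ℤ) :
    (D₁.prod D₂).hodgeLocusOfNormLe p K = D₁.hodgeLocusOfNormLe p K ∪ D₂.hodgeLocusOfNormLe p K := by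
  refine Set.Subset.antisymm ?_ (union_hodgeLocusOfNormLe_subset_prod D₁ D₂ p K)
  rintro s ⟨u, hu0, hu, hK⟩
  obtain ⟨u₁, u₂⟩ := u
  obtain ⟨h₁, h₂⟩ := (isHodgeAt_prod_iff D₁ D₂ s p u₁ u₂).1 hu
  change ((D₁.prod D₂).form s).form ((D₁.prod D₂).toRat s (u₁, u₂)) ((D₁.prod D₂).toRat s (u₁, u₂)) ≤ (K : ℚ) at hK
  rw [prod_toRat_apply, prod_form_form] at hK
  have h₁' := form_toRat_self_nonneg hp h₁
  have h₂' := form_toRat_self_nonneg hp h₂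
  by_cases hu₁ : u₁ = 0
  · have hu₂ : u₂ ≠ 0 := fun h => hu0 (by rw [hu₁, h]; rfl)
    exact Or.inr ⟨u₂, hu₂, h₂, by dsimp only at hK; linarith⟩
  · exact Or.inl ⟨u₁, hu₁, h₁, by dsimp only at hK; linarith⟩

/-- Determination loci of `(u, 0)` in `D₁ ⊕ D₂` are those of `u` in `D₁`. [cite: CattaniDeligneKaplan1995, §1, Cor. 1.3] -/
theorem setOf_exists_isHodgeAt_transport_prod_inl (s : S) (p : ℤ) (u : D₁.VZ.fiber s) :
    {t : S | ∃ γ : Path.Homotopic.Quotient s t, (D₁.prod D₂).IsHodgeAt t p ((D₁.prod D₂).VZ.transport γ ((u, 0) : D₁.VZ.fiber s × D₂.VZ.fiber s))} =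
      {t : S | ∃ γ : Path.Homotopic.Quotient s t, D₁.IsHodgeAt t p (D₁.VZ.transport γ u)} := by
  ext t
  refine exists_congr fun γ => ?_
  change (D₁.prod D₂).IsHodgeAt t p ((D₁.VZ.transport γ u, D₂.VZ.transport γ 0) : D₁.VZ.fiber t × D₂.VZ.fiber t) ↔ _
  rw [map_zero]
  exact isHodgeAt_prod_inl_iff D₁ D₂ t p _

/-- Determination loci of `(0, u)` in `D₁ ⊕ D₂` are those of `u` in `D₂`. [cite: CattaniDeligneKaplan1995, §1, Cor. 1.3] -/
theorem setOf_exists_isHodgeAt_transport_prod_inr (s : S) (p : ℤ) (u : D₂.VZ.fiber s) :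
    {t : S | ∃ γ : Path.Homotopic.Quotient s t, (D₁.prod D₂).IsHodgeAt t p ((D₁.prod D₂).VZ.transport γ ((0, u) : D₁.VZ.fiber s × D₂.VZ.fiber s))} =
      {t : S | ∃ γ : Path.Homotopic.Quotient s t, D₂.IsHodgeAt t p (D₂.VZ.transport γ u)} := by
  ext t
  refine exists_congr fun γ => ?_
  change (D₁.prod D₂).IsHodgeAt t p ((D₁.VZ.transport γ 0, D₂.VZ.transport γ u) : D₁.VZ.fiber t × D₂.VZ.fiber t) ↔ _
  rw [map_zero]
  exact isHodgeAt_prod_inr_iff D₁ D₂ t p _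

/-- Morphisms into a direct sum: `u` is carried to a Hodge class by `(φ, ψ)` iff it is by `φ` and by `ψ`. [cite: DeligneHodgeII1971, 2.1] -/
theorem isHodgeAt_prodLift_app_iff {D : VHSData S k} (φ : Hom D D₁) (ψ : Hom D D₂) (s : S) (p : ℤ) (u : D.VZ.fiber s) :
    (D₁.prod D₂).IsHodgeAt s p ((φ.prodLift ψ).app s u) ↔ D₁.IsHodgeAt s p (φ.app s u) ∧ D₂.IsHodgeAt s p (ψ.app s u) :=
  isHodgeAt_prod_iff D₁ D₂ s p _ _

end Loci

end VHSData

end Literature.AlgebraicGeometry.Motives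

end
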